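import Mathlib
import Summits.Parity.GeneralizedHardyLittlewood.Theorems.FordMaynardSieveConst01651SieveConst01651GreedyBlocksNat

/-!
# Route `FordMaynardSieveConst01651`, target `SieveConst01651` (stmt-Parity-19185), line `sieve_decomposition`:
# helpers towards `stub_typeIIRegion` — peeling the FIRST block of Ford–Maynard's decomposition (7.12), integer form

With a block-tuple function `T` as provided by `…GreedyBlocksNat.exists_blockTuple_fn` (threshold `L ≥ 1`), the
re-indexing `u ↦ (m, u') = (first block, rest)` used to exhibit the Type-II variable needs the INTEGER criterion
"`m` is the first block of `m u'` and the remaining blocks are those of `u'`":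
`T (m u') = m :: T u'` iff `1 < m ≤ L · P⁻(m)`, every prime of `u'` is `≤` every prime of `m`
(the printed `P⁻(d₁) ≥ P⁺(d₂)`), and `m > L` unless `u' = 1`.  Of these only the prime comparison and the
dichotomy `u' = 1 ∨ L < m` couple `m` with `u'` — an INTEGER comparison (gap, `BilinBoundedBy.threshold` /
`…BilinTools.bilin_threshold_nat_le`) and a sum of two separable indicators.

* `blockTuple_eq_nil_iff` — `T d = [] ↔ d = 1`;
* `blockTuple_cons_iff` — the criterion above.

Def-free (the spec of `T` is a hypothesis, verbatim the conclusion of `exists_blockTuple_fn`). Nothing here proves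
anything about the Parity summit; helpers for the Type-II region stub of one leaf.
-/

namespace Summit.Parity.GeneralizedHardyLittlewood.FordMaynardSieveConst01651SieveConst01651

/-- `T d = []` iff `d = 1` (for `d ≠ 0`). [cite: FordMaynard2024PrimeSieves, (7.12)] -/
theorem blockTuple_eq_nil_iff {L : ℝ} {T : ℕ → List ℕ}
    (hT : ∀ d : ℕ, d ≠ 0 →
      ((T d).prod = d ∧ (∀ e ∈ T d, 1 < e) ∧
        (T d).Pairwise (fun e e' => ∀ p ∈ e'.primeFactorsList, ∀ q ∈ e.primeFactorsList, p ≤ q) ∧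
        (∀ e ∈ T d, (e : ℝ) ≤ L * (e.minFac : ℝ)) ∧ (∀ e ∈ (T d).dropLast, L < (e : ℝ))) ∧
      ∀ D : List ℕ, D.prod = d → (∀ e ∈ D, 1 < e) →
        D.Pairwise (fun e e' => ∀ p ∈ e'.primeFactorsList, ∀ q ∈ e.primeFactorsList, p ≤ q) →
        (∀ e ∈ D, (e : ℝ) ≤ L * (e.minFac : ℝ)) → (∀ e ∈ D.dropLast, L < (e : ℝ)) → D = T d)
    {d : ℕ} (hd : d ≠ 0) : T d = [] ↔ d = 1 := by
  obtain ⟨⟨hprod, hone, _, _, _⟩, huniq⟩ := hT d hd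
  constructor
  · intro h
    rw [← hprod, h, List.prod_nil]
  · intro h
    subst h
    exact (huniq [] (by simp) (by simp) (by simp) (by simp) (by simp)).symm

/-- **First-block criterion, integer form.** For `m, u' ≥ 1`: `T (m u') = m :: T u'` iff `1 < m`,
`m ≤ L · P⁻(m)`, every prime factor of `u'` is `≤` every prime factor of `m`, and `u' ≠ 1 → L < m`.
[cite: FordMaynard2024PrimeSieves, (7.12) and Lemma 7.17 (proof)] -/
theorem blockTuple_cons_iff {L : ℝ} {T : ℕ → List ℕ}
    (hT : ∀ d : ℕ, d ≠ 0 →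
      ((T d).prod = d ∧ (∀ e ∈ T d, 1 < e) ∧
        (T d).Pairwise (fun e e' => ∀ p ∈ e'.primeFactorsList, ∀ q ∈ e.primeFactorsList, p ≤ q) ∧
        (∀ e ∈ T d, (e : ℝ) ≤ L * (e.minFac : ℝ)) ∧ (∀ e ∈ (T d).dropLast, L < (e : ℝ))) ∧
      ∀ D : List ℕ, D.prod = d → (∀ e ∈ D, 1 < e) →
        D.Pairwise (fun e e' => ∀ p ∈ e'.primeFactorsList, ∀ q ∈ e.primeFactorsList, p ≤ q) →
        (∀ e ∈ D, (e : ℝ) ≤ L * (e.minFac : ℝ)) → (∀ e ∈ D.dropLast, L < (e : ℝ)) → D = T d)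
    {m u' : ℕ} (hm : m ≠ 0) (hu' : u' ≠ 0) :
    T (m * u') = m :: T u' ↔
      (1 < m ∧ (m : ℝ) ≤ L * (m.minFac : ℝ) ∧
        (∀ p ∈ u'.primeFactorsList, ∀ q ∈ m.primeFactorsList, p ≤ q) ∧ (u' ≠ 1 → L < (m : ℝ))) := by
  obtain ⟨⟨hprod', hone', hpw', hmin', hlast'⟩, _⟩ := hT u' hu'
  obtain ⟨⟨hprod, hone, hpw, hmin, hlast⟩, huniq⟩ := hT (m * u') (mul_ne_zero hm hu')
  -- primes of `u'` are the primes of the blocks of `T u'`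
  have hprimes : ∀ p, p ∈ u'.primeFactorsList ↔ ∃ e ∈ T u', p ∈ e.primeFactorsList := by
    intro p
    rw [Nat.mem_primeFactorsList hu']
    constructor
    · rintro ⟨hp, hpd⟩
      rw [← hprod'] at hpd
      obtain ⟨e, he, hpe⟩ := (Prime.dvd_prod_iff hp.prime).mp hpd
      exact ⟨e, he, (Nat.mem_primeFactorsList (by linarith [hone' e he])).mpr ⟨hp, hpe⟩⟩
    · rintro ⟨e, he, hpe⟩
      obtain ⟨hp, hpe'⟩ := (Nat.mem_primeFactorsList (by linarith [hone' e he])).mp hpe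
      exact ⟨hp, hpe'.trans (hprod' ▸ List.dvd_prod he)⟩
  have hTnil : T u' = [] ↔ u' = 1 := blockTuple_eq_nil_iff hT hu'
  constructor
  · intro h
    have hm_mem : m ∈ T (m * u') := by rw [h]; exact List.mem_cons_self
    refine ⟨hone m hm_mem, hmin m hm_mem, ?_, ?_⟩
    · intro p hp q hq
      obtain ⟨e, he, hpe⟩ := (hprimes p).mp hp
      rw [h, List.pairwise_cons] at hpw
      exact hpw.1 e he p hpe q hq
    · intro hu1
      have hne : T u' ≠ [] := fun h0 => hu1 (hTnil.mp h0)
      apply hlast m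
      rw [h, List.dropLast_cons_of_ne_nil hne]
      exact List.mem_cons_self
  · rintro ⟨h1m, hminm, hcmp, hLm⟩
    symm
    refine huniq (m :: T u') ?_ ?_ ?_ ?_ ?_
    · rw [List.prod_cons, hprod']
    · intro e he
      rcases List.mem_cons.mp he with rfl | he
      · exact h1m
      · exact hone' e he
    · rw [List.pairwise_cons]
      refine ⟨fun e he p hp q hq => hcmp p ((hprimes p).mpr ⟨e, he, hp⟩) q hq, hpw'⟩
    · intro e he
      rcases List.mem_cons.mp he with rfl | he
      · exact hminm
      · exact hmin' e he
    · intro e he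
      by_cases hne : T u' = []
      · rw [hne] at he; simp at he
      · rw [List.dropLast_cons_of_ne_nil hne] at he
        rcases List.mem_cons.mp he with rfl | he
        · exact hLm fun h1 => hne (hTnil.mpr h1)
        · exact hlast' e he

end Summit.Parity.GeneralizedHardyLittlewood.FordMaynardSieveConst01651SieveConst01651
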